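import Mathlib.Analysis.SpecialFunctions.Pow.Real
import Mathlib.Data.Fintype.Powerset
import Mathlib.Data.Fintype.Prod
import Mathlib.Data.ZMod.Basic
import HarnessLib

/-!
# Pratt 2024: equilateral trapezoid-free triples, `Val(G)`, and the two-families transfer

K. Pratt, *On generalized corners and matrix multiplication*, ITCS 2024 (LIPIcs 287, 89),
arXiv:2309.03878 [Pratt2024] — numbering of the arXiv text, read pp. 5–10 (§2 Conj. 2.5, §3
Def. 3.2, Props. 3.3–3.4, §4 Prop. 4.3, Thms. 4.4, 4.7).

* `IsEquilateralTrapezoidFree A B C` — **Definition 3.2**, in additive notation (`a + b + c = 0`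
  for Pratt's `abc = I`, the order of the three summands kept): for all fixed `a' ∈ A`, `b' ∈ B`,
  `c' ∈ C`, each of the three systems `0 = a'+b+c = a+b'+c`, `0 = a'+b+c = a+b+c'`,
  `0 = a+b'+c = a+b+c'` in the unknowns `(a, b, c) ∈ A × B × C` has at most one solution.
* `zeroSumTriples A B C` — the solutions of `a + b + c = 0` in `A × B × C`; `prattVal G` —
  **`Val(G)`**: "the maximum number of solutions to `abc = I` over all equilateral trapezoid-free
  triples `(A,B,C)`" (a `Finset.sup` over all triples of subsets of the finite group `G`).
* PROVED API: `card_zeroSumTriples_le_prattVal` (every trapezoid-free triple bounds `Val` from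
  below), `exists_prattVal_eq` (the maximum is attained), and the lower half of **Proposition 3.4**
  (`|G| ≤ Val(G)`, witnessed by `(G, {0}, G)`): `card_le_prattVal`.
* NAMED FACT `pratt2024_thm47` — **Theorem 4.7**: "If Conjecture 2.5 [= Cohn–Kleinberg–Szegedy–Umans
  2005, Conj. 4.7, 'two families'] is true, then for any `ε > 0`, `Val(ℤ_n) ≥ O(n^{4/3-ε})`", in
  the reading the printed proof delivers (see below): the two-families conjecture implies that for
  every `ε > 0` there are infinitely many `N` with `Val(ℤ/Nℤ) ≥ N^{4/3-ε}`.

## The hypothesis and the reading of Theorem 4.7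

The antecedent is CKSU's Conjecture 4.7 exactly as the routes MatrixMultiplication/GroupTheoreticSTPP
(`CPackingConstruction`) and MatrixMultiplication/FourierTwoFamilies (`TwoFamiliesRefutation = ¬ …`)
inline it: for every `δ > 0` and arbitrarily large `n` there are a finite abelian group `H` with
`|H| ≤ n^{2+δ}` and `n` pairs `(A_i, B_i)` of subsets with `|A_i||B_i| ≥ n^{2-δ}` having the
simultaneous double product property (each pair has the double product property
`(a-a')+(b-b') = 0 ⇒ a = a', b = b'`, and `(a_i - a'_j) + (b_j - b'_k) = 0 ⇒ i = k`)
[CohnKleinbergSzegedyUmans2005, Conj. 4.7; Pratt2024, Conj. 2.5].  The printed conclusion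
"`Val(ℤ_n) ≥ O(n^{4/3-ε})`" is loose notation; the proof (p. 10: corner-free `S ⊂ Δ_n` of size
`n^{2-o(1)}`, SDPP → STPP in `H³`, Freiman-type embedding `H³ ↪ ℤ/N'ℤ` with `N' ≤ n^{6+δ}` by
[BlasiakChurchCohnGrochowNaslundSawinUmans2017], and Prop. 3.3) produces, for each `n` supplied by
the conjecture, ONE modulus `N' ≤ n^{6+δ}` with `Val(ℤ/N'ℤ) > n^{8-o(1)} ≥ N'^{4/3-ε}`; since the
conjecture only supplies arbitrarily large `n`, the honest statement is "for infinitely many `N`",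
which is what `pratt2024_thm47` says (and what a refutation `Val(ℤ/Nℤ) = O(N^{4/3-ε₀})` for ALL
large `N` contradicts).

## What is NOT here

The upper half of Prop. 3.4 (`Val(G) ≤ |G|^{3/2}`, Prop. 3.1's Cauchy–Schwarz), Prop. 3.5
(super-multiplicativity), Thm. 3.7 (`Val(G) = o(|G|^{3/2})`), Conj. 4.1, Prop. 4.3, Thm. 4.4 and
Cor. 4.5 — separate cite items if wanted; none is asserted.

## References

* [Pratt2024] K. Pratt, arXiv:2309.03878 = ITCS 2024: Def. 3.2, Prop. 3.3, Prop. 3.4, Thm. 4.7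
  (with its proof, p. 10), Conj. 2.5.
* [CohnKleinbergSzegedyUmans2005] H. Cohn, R. Kleinberg, B. Szegedy, C. Umans, FOCS 2005,
  Conj. 4.7 (two families), §4 (double product property, SDPP).
* [BlasiakChurchCohnGrochowNaslundSawinUmans2017] Discrete Analysis 2017:3, Thm. A′ (used in the
  printed proof to bound the small-order part of `H³`).
-/

noncomputable section

namespace Literature.Computability.AlgebraicComplexity

open Finset

section Defs

variable {G : Type*} [AddGroup G] [DecidableEq G]

/-- The solutions of `a + b + c = 0` with `(a, b, c) ∈ A × B × C` (the hyperedges of Pratt's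
hypergraph `X_G` induced on `A ⊆ X₁`, `B ⊆ X₂`, `C ⊆ X₃`; additive notation for `abc = I`).
[cite: Pratt2024, §2 (the hypergraph X_G) and Def. 3.2] -/
def zeroSumTriples (A B C : Finset G) : Finset (G × G × G) :=
  (A ×ˢ B ×ˢ C).filter fun t => t.1 + t.2.1 + t.2.2 = 0

/-- Membership in `zeroSumTriples`. [folklore] -/
theorem mem_zeroSumTriples {A B C : Finset G} {t : G × G × G} :
    t ∈ zeroSumTriples A B C ↔ (t.1 ∈ A ∧ t.2.1 ∈ B ∧ t.2.2 ∈ C) ∧ t.1 + t.2.1 + t.2.2 = 0 := by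
  simp [zeroSumTriples, and_assoc]

/-- **Pratt 2024, Definition 3.2 (equilateral trapezoid-free triple)**, additive notation: for any
fixed `a' ∈ A`, `b' ∈ B`, `c' ∈ C`, each of the systems `0 = a'+b+c = a+b'+c`,
`0 = a'+b+c = a+b+c'`, `0 = a+b'+c = a+b+c'` in the variables `a ∈ A`, `b ∈ B`, `c ∈ C` has at
most one solution `(a, b, c)` (equivalently: in the induced subhypergraph of `X_G` two vertices
from different parts have at most one common neighbour in the third part, Prop. 3.1).
[cite: Pratt2024, Def. 3.2] -/
def IsEquilateralTrapezoidFree (A B C : Finset G) : Prop :=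
  (∀ a' ∈ A, ∀ b' ∈ B,
      #((A ×ˢ B ×ˢ C).filter fun t => a' + t.2.1 + t.2.2 = 0 ∧ t.1 + b' + t.2.2 = 0) ≤ 1) ∧
  (∀ a' ∈ A, ∀ c' ∈ C,
      #((A ×ˢ B ×ˢ C).filter fun t => a' + t.2.1 + t.2.2 = 0 ∧ t.1 + t.2.1 + c' = 0) ≤ 1) ∧
  (∀ b' ∈ B, ∀ c' ∈ C,
      #((A ×ˢ B ×ˢ C).filter fun t => t.1 + b' + t.2.2 = 0 ∧ t.1 + t.2.1 + c' = 0) ≤ 1)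

/-- The empty triple is equilateral trapezoid-free. [folklore] -/
theorem isEquilateralTrapezoidFree_empty :
    IsEquilateralTrapezoidFree (∅ : Finset G) ∅ ∅ := by
  refine ⟨?_, ?_, ?_⟩ <;> simp

variable [Fintype G]

/-- **`Val(G)`** (Pratt 2024, Def. 3.2): the maximum number of solutions of `a + b + c = 0`,
`(a,b,c) ∈ A × B × C`, over all equilateral trapezoid-free triples `(A, B, C)` of subsets of the
finite group `G` — the supremum of a nonempty set of naturals bounded by `|G|³`, hence a maximum
(`exists_prattVal_eq`). [cite: Pratt2024, Def. 3.2] -/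
def prattVal (G : Type*) [AddGroup G] [DecidableEq G] [Fintype G] : ℕ :=
  sSup {k : ℕ | ∃ A B C : Finset G, IsEquilateralTrapezoidFree A B C ∧ #(zeroSumTriples A B C) = k}

/-- The set of solution counts of trapezoid-free triples is bounded (by `|G|³`). [folklore] -/
theorem bddAbove_prattVal_set :
    BddAbove {k : ℕ | ∃ A B C : Finset G,
      IsEquilateralTrapezoidFree A B C ∧ #(zeroSumTriples A B C) = k} := by
  refine ⟨Fintype.card (G × G × G), ?_⟩
  rintro k ⟨A, B, C, -, rfl⟩
  exact card_le_univ _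

/-- Every equilateral trapezoid-free triple bounds `Val(G)` from below by its number of solutions
(the definition of `Val` as a maximum; cf. Prop. 3.3). [cite: Pratt2024, Def. 3.2 and Prop. 3.3] -/
theorem card_zeroSumTriples_le_prattVal {A B C : Finset G} (h : IsEquilateralTrapezoidFree A B C) :
    #(zeroSumTriples A B C) ≤ prattVal G :=
  le_csSup bddAbove_prattVal_set ⟨A, B, C, h, rfl⟩

/-- `Val(G)` is attained by some equilateral trapezoid-free triple. [cite: Pratt2024, Def. 3.2] -/
theorem exists_prattVal_eq :
    ∃ A B C : Finset G, IsEquilateralTrapezoidFree A B C ∧ #(zeroSumTriples A B C) = prattVal G := by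
  have hne : {k : ℕ | ∃ A B C : Finset G,
      IsEquilateralTrapezoidFree A B C ∧ #(zeroSumTriples A B C) = k}.Nonempty :=
    ⟨_, ∅, ∅, ∅, isEquilateralTrapezoidFree_empty, rfl⟩
  obtain ⟨A, B, C, h, hk⟩ := Nat.sSup_mem hne bddAbove_prattVal_set
  exact ⟨A, B, C, h, hk⟩

/-- The triple `(G, {0}, G)` is equilateral trapezoid-free: in each of the three systems the
middle unknown is forced to be `0` and then one equation determines each remaining unknown.
[cite: Pratt2024, Prop. 3.4 (lower bound)] -/
theorem isEquilateralTrapezoidFree_univ_zero_univ :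
    IsEquilateralTrapezoidFree (univ : Finset G) {0} univ := by
  refine ⟨fun a' _ b' _ => ?_, fun a' _ c' _ => ?_, fun b' hb0 c' _ => ?_⟩
  · refine card_le_one.2 fun t ht t' ht' => ?_
    simp only [mem_filter, mem_product, mem_univ, mem_singleton, true_and, and_true] at ht ht'
    obtain ⟨hb, h1, h2⟩ := ht
    obtain ⟨hb2, h1', h2'⟩ := ht'
    rw [hb, add_zero] at h1
    rw [hb2, add_zero] at h1'
    have hc : t.2.2 = t'.2.2 := by
      rw [← neg_eq_of_add_eq_zero_right h1, ← neg_eq_of_add_eq_zero_right h1']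
    have ha : t.1 = t'.1 := by
      rw [add_assoc] at h2 h2'
      rw [eq_neg_of_add_eq_zero_left h2, eq_neg_of_add_eq_zero_left h2', hc]
    exact Prod.ext ha (Prod.ext (hb.trans hb2.symm) hc)
  · refine card_le_one.2 fun t ht t' ht' => ?_
    simp only [mem_filter, mem_product, mem_univ, mem_singleton, true_and, and_true] at ht ht'
    obtain ⟨hb, h1, h2⟩ := ht
    obtain ⟨hb2, h1', h2'⟩ := ht'
    rw [hb, add_zero] at h1 h2
    rw [hb2, add_zero] at h1' h2'
    have hc : t.2.2 = t'.2.2 := by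
      rw [← neg_eq_of_add_eq_zero_right h1, ← neg_eq_of_add_eq_zero_right h1']
    have ha : t.1 = t'.1 := by
      rw [eq_neg_of_add_eq_zero_left h2, eq_neg_of_add_eq_zero_left h2']
    exact Prod.ext ha (Prod.ext (hb.trans hb2.symm) hc)
  · refine card_le_one.2 fun t ht t' ht' => ?_
    simp only [mem_filter, mem_product, mem_univ, mem_singleton, true_and, and_true] at ht ht'
    obtain ⟨hb, h1, h2⟩ := ht
    obtain ⟨hb2, h1', h2'⟩ := ht'
    rw [mem_singleton] at hb0
    rw [hb0, add_zero] at h1 h1'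
    rw [hb, add_zero] at h2
    rw [hb2, add_zero] at h2'
    have ha : t.1 = t'.1 := by
      rw [eq_neg_of_add_eq_zero_left h2, eq_neg_of_add_eq_zero_left h2']
    have hc : t.2.2 = t'.2.2 := by
      rw [← neg_eq_of_add_eq_zero_right h1, ← neg_eq_of_add_eq_zero_right h1', ha]
    exact Prod.ext ha (Prod.ext (hb.trans hb2.symm) hc)

/-- The triple `(G, {0}, G)` has exactly `|G|` solutions `(a, 0, -a)`. [cite: Pratt2024, Prop. 3.4 (lower bound)] -/
theorem card_zeroSumTriples_univ_zero_univ :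
    #(zeroSumTriples (univ : Finset G) {0} univ) = Fintype.card G := by
  classical
  have himage : zeroSumTriples (univ : Finset G) {0} univ =
      (univ : Finset G).image fun a => (a, (0 : G), -a) := by
    ext t
    simp only [mem_zeroSumTriples, mem_univ, mem_singleton, true_and, and_true, mem_image]
    constructor
    · rintro ⟨hb, hsum⟩
      refine ⟨t.1, ?_⟩
      rw [hb, add_zero] at hsum
      have hc : t.2.2 = -t.1 := (neg_eq_of_add_eq_zero_right hsum).symm
      exact Prod.ext rfl (Prod.ext hb.symm hc.symm)
    · rintro ⟨a, rfl⟩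
      exact ⟨rfl, by simp⟩
  rw [himage, card_image_of_injective _ fun a b h => (Prod.ext_iff.1 h).1, card_univ]

/-- **Pratt 2024, Proposition 3.4 (lower bound)**: `|G| ≤ Val(G)` for every finite group `G`.
[cite: Pratt2024, Prop. 3.4] -/
theorem card_le_prattVal : Fintype.card G ≤ prattVal G := by
  rw [← card_zeroSumTriples_univ_zero_univ (G := G)]
  exact card_zeroSumTriples_le_prattVal isEquilateralTrapezoidFree_univ_zero_univ

end Defs

/-! ### Theorem 4.7: the two-families conjecture forces `Val(ℤ/Nℤ) ≥ N^{4/3-ε}` infinitely often -/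

/-- **Pratt 2024, Theorem 4.7** (named fact): "If Conjecture 2.5 [CKSU 2005, Conj. 4.7: for
arbitrarily large `n` there is an abelian group `H` of order `n^{2+o(1)}` and `n` pairs of sets
`(A_i, B_i)` with `|A_i||B_i| > n^{2-o(1)}` satisfying the simultaneous double product property] is
true, then for any `ε > 0`, `Val(ℤ_n) ≥ O(n^{4/3-ε})`" — rendered as: the two-families conjecture
(inlined verbatim as in routes GroupTheoreticSTPP.`CPackingConstruction` and
FourierTwoFamilies.`TwoFamiliesRefutation`) implies that for every `ε > 0` and every `N₀` there is
`N ≥ N₀` with `N^{4/3-ε} ≤ Val(ℤ/Nℤ)` (infinitely many `N`: what the printed proof gives; module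
docstring).  Proof in print: corner-free `S ⊂ Δ_n` of size `n^{2-o(1)}`; SDPP → STPP with `|S|`
triples of size `n^{2-o(1)}` in `H³`; mixed-radix embedding `H³ ↪ ℤ/N'ℤ`, `N' ≤ n^{6+δ}` (small-order
part of `H³` bounded by Blasiak et al. 2017); Prop. 3.3 gives `Val(ℤ/N'ℤ) > n^{8-o(1)}`.
[cite: Pratt2024, Thm. 4.7] [cite: CohnKleinbergSzegedyUmans2005, Conj. 4.7] -/
def pratt2024_thm47 : Prop :=
  (∀ δ : ℝ, 0 < δ → ∀ n₀ : ℕ, ∃ n ≥ n₀, ∃ (H : Type) (_ : AddCommGroup H) (_ : Fintype H)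
      (A B : Fin n → Finset H),
      (∀ i : Fin n, ∀ a ∈ A i, ∀ a' ∈ A i, ∀ b ∈ B i, ∀ b' ∈ B i,
          (a - a') + (b - b') = 0 → a = a' ∧ b = b') ∧
      (∀ i j k : Fin n, ∀ a ∈ A i, ∀ a' ∈ A j, ∀ b ∈ B j, ∀ b' ∈ B k,
          (a - a') + (b - b') = 0 → i = k) ∧
      (Fintype.card H : ℝ) ≤ (n : ℝ) ^ (2 + δ) ∧
      ∀ i : Fin n, (n : ℝ) ^ (2 - δ) ≤ (((A i).card * (B i).card : ℕ) : ℝ)) →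
  ∀ ε : ℝ, 0 < ε → ∀ N₀ : ℕ, ∃ N : ℕ, ∃ _ : NeZero N, N₀ ≤ N ∧
    (N : ℝ) ^ (4 / 3 - ε) ≤ (prattVal (ZMod N) : ℝ)

end Literature.Computability.AlgebraicComplexity

end
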